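import Mathlib.Analysis.Complex.Basic
import Mathlib.Analysis.Calculus.Deriv.Basic
import Mathlib.Topology.Covering.Basic
import HarnessLib

/-!
# Uniformization of plane domains: the unit disc covers every plane domain omitting two points

Topic `Literature/Analysis/Complex` — the NAMED FACT (D-0014: a published result not yet proved in the
tree, stated as a `Prop` to be consumed by name and discharged later by `planeDomainDiscCovering_holds`)
behind the uniformization of the hyperbolic Riemann surfaces of genus `≤ 1`:

> **Theorem** (Koebe 1908; Poincaré 1907; elementary proof: Y. Fisher, J. H. Hubbard, B. S. Wittner,
> *A proof of the uniformization theorem for arbitrary plane domains*, Proc. Amer. Math. Soc. **104**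
> (1988) 413–418, Theorem p. 413). *If `U ⊂ ℂ` is a connected open set whose complement contains at
> least two points, then the universal covering space of `U` is (analytically isomorphic to) the unit
> disc `𝔻`.*

Equivalently (the disc being simply connected, a holomorphic covering map `𝔻 → U` IS a universal
covering): there is a holomorphic covering map of `U` by the open unit disc.  We type exactly this
existence statement, planar style (a function `f : ℂ → ℂ` holomorphic on `ball 0 1`, mapping the ball
ONTO `U`, whose restriction `ball 0 1 → U` is a covering map in Mathlib's sense `IsCoveringMap`), the
shape of the tree's Riemann mapping theorem `Complex.exists_bijOn_ball_of_isSimplyConnected`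
(`Literature/Analysis/Complex/RiemannMapping.lean`), which is the simply connected case.

* `Complex.PlaneDomainDiscCovering` — the named fact (statement only; corollaries such as the
  cofinite case `ℂ ∖ S` live with the consumers).

Intended discharge (abc-iut cell, seat abc-iut-L4-t8, GAP row G-L4t8g7-1, programme «UNIF-G1P»),
following Fisher–Hubbard–Wittner with the tree's assets: normality of the family of holomorphic maps
`𝔻 → ℂ ∖ {0,1}` with prescribed value at `0` (lift through the tree's covering
`isCoveringMap_modularLambda` `λ : ℍ → ℂ ∖ {0,1}`, then Montel `Complex.exists_strictMono_tendstoLocallyUniformlyOn_of_norm_le`);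
existence of a map `f : 𝔻 → U`, `f 0 = a`, maximising `‖f′(0)‖` (Hurwitz
`Complex.hurwitz_eqOn_zero_or_forall_ne_zero` keeps the limit inside `U`); the extremal map is a
covering.  CONSUMERS: `Literature/Geometry/Kaehler/` (holomorphic universal covering by the disc of
`T ∖ S`, `T` a complex torus, `S ≠ ∅` finite — via the plane domain `ℂ ∖ π⁻¹(S)`) and
`Literature/AnabelianGeometry/AbsoluteAnabelian/` (the universal-covering hypotheses `IsAutHolDisc` of
[AbsTopIII] Cor. 2.4 / 2.7 at the genuine once-punctured elliptic curves).  Declarations live in the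
`Complex` namespace, as in `RiemannMapping.lean`, `Montel.lean`, `Hurwitz.lean`.

## References
* [FisherHubbardWittner1988] Y. Fisher, J. H. Hubbard, B. S. Wittner, Proc. AMS 104 (1988) 413–418.
* [Lin2011ClassicalComplexAnalysisII] I-Hsiung Lin, *Classical Complex Analysis: A Geometric Approach*,
  vol. 2 (2011), (7.6.1) (the uniformization theorem; plane domains are the case of §7.6.2).
-/

noncomputable section

open Set Metric Function

namespace Complex

/-- **Uniformization of plane domains** (Koebe–Poincaré; Fisher–Hubbard–Wittner 1988, Theorem
p. 413: "if `U ⊂ ℂ` is a connected open set whose complement contains at least two points, then the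
universal covering space of `U` is the disc"): for every connected open `U ⊆ ℂ` omitting two distinct
points there is `f : ℂ → ℂ`, holomorphic on the open unit disc, mapping the disc onto `U`, whose
restriction `ball 0 1 → U` is a covering map (hence, the disc being simply connected, a holomorphic
universal covering of `U`).  NAMED FACT (typed statement; the tree's proof is pending).
[cite: FisherHubbardWittner1988, Theorem p.413] -/
def PlaneDomainDiscCovering : Prop :=
  ∀ U : Set ℂ, IsOpen U → IsConnected U → (∃ a b : ℂ, a ≠ b ∧ a ∉ U ∧ b ∉ U) →
    ∃ f : ℂ → ℂ, DifferentiableOn ℂ f (ball (0 : ℂ) 1) ∧ SurjOn f (ball (0 : ℂ) 1) U ∧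
      ∃ h : MapsTo f (ball (0 : ℂ) 1) U, IsCoveringMap h.restrict

end Complex

end
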